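import Literature.Analysis.Complex.PlaneCurveSheetSum
import Mathlib.Analysis.Calculus.LineDeriv.IntegrationByParts
import Mathlib.Analysis.Calculus.BumpFunction.InnerProduct
import Mathlib.Analysis.Calculus.FDeriv.CompCLM
import Mathlib.MeasureTheory.Integral.MeanInequalities
import HarnessLib

/-!
# Stokes' theorem for the sheet-sum current of an analytic curve in `ℂ²` (local form)

For a bi-Weierstrass curve `Z ⊆ ℂ × ℂ` (`Literature/Analysis/Complex/PlaneCurveSheetSum.lean`)
and a `C¹` field of real-linear `ℂ`-valued covectors `β : ℂ × ℂ → (ℂ × ℂ →L[ℝ] ℂ)` (a complex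
valued `1`-form) with compact support inside a `z`-box `B`, we prove
**`∫ sheetSum Z (dDensity β) = 0`** (`ZBox.integral_sheetSum_dDensity_eq_zero`), where
`dDensity β q σ = dβ_q ((1, σ), (i, iσ))` is the density of the `2`-form `dβ` on the complex line
of slope `σ`; i.e. `∫_Z dβ = 0` — Stokes' theorem for analytic curves (Griffiths–Harris, Ch. 0
§2, "Stokes' theorem for analytic varieties"; Lelong (1957); Chirka (1989), §14.2 Prop. 3,
`d[A] = 0`), in the concrete `z`-projection form needed downstream.

Proof (the classical one, loc. cit.): over the good set of the box the curve is a union of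
holomorphic graphs `w = β_i (z)`; the pull-backs of `β` to the `z`-disc have components
`P = Σ_i β (1, β_i')`, `Q = Σ_i β (i, i β_i')` (the sheet sums of `fstDensity β`,
`sndDensity β`), of class `C¹` off the finitely many discriminant points in the support, square
integrable by the local area bound, with `∂₁ Q - ∂_i P = sheetSum Z (dDensity β)` (holomorphy of
the sheets: the second derivatives `β_i''` cancel, `hasFDerivAt_fstDensity_graph`,
`fderiv_sndDensity_sub_fderiv_fstDensity`). Cutting off `ε`-discs around the singular points
with `ψ_ε` (`PlaneCurve.cutoff`), `ψ_ε P`, `ψ_ε Q` are `C¹` with compact support, so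
`∫ (∂₁ (ψ_ε Q) - ∂_i (ψ_ε P)) = 0` (integration by parts,
`integral_mul_fderiv_eq_neg_fderiv_mul_of_integrable`); the error
`∫ (∂₁ψ_ε · Q - ∂_iψ_ε · P)` is `O(ε⁻¹ · ε · ‖(P, Q)‖_{L²(ε-discs)}) → 0` by Cauchy–Schwarz, and
`∫ (1 - ψ_ε) · sheetSum Z (dDensity β) → 0` by absolute continuity.

## References

* P. Griffiths, J. Harris, *Principles of Algebraic Geometry*, Wiley 1978, Ch. 0 §2 (Stokes'
  theorem for analytic varieties). [GriffithsHarrisPrinciples1978]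
* E. M. Chirka, *Complex Analytic Sets*, Kluwer 1989, §14.1–14.2. [Chirka1989]
* P. Lelong, *Intégration sur un ensemble analytique complexe*, Bull. SMF 85 (1957) 239–262.
-/

noncomputable section

open Set Filter Metric Topology Complex MeasureTheory
open scoped ENNReal NNReal
open Literature.Analysis.Complex.SCV

namespace Literature.Analysis.Complex

namespace PlaneCurve

variable {Z : Set (ℂ × ℂ)}

/-! ### Densities of a `1`-form and of its exterior derivative on complex lines -/

/-- Real-linear multiplication by `c` on `ℂ`, `h ↦ h c`. [folklore] -/
def mulCLM (c : ℂ) : ℂ →L[ℝ] ℂ :=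
  (ContinuousLinearMap.smulRight (1 : ℂ →L[ℂ] ℂ) c).restrictScalars ℝ

/-- `mulCLM c h = h * c`. [folklore] -/
@[simp] theorem mulCLM_apply (c h : ℂ) : mulCLM c h = h * c := by
  simp [mulCLM]

/-- The real derivative of the graph map `z ↦ (z, α z)`: `h ↦ (h, h α'(z))`. [folklore] -/
def graphDeriv (s : ℂ) : ℂ →L[ℝ] ℂ × ℂ := (ContinuousLinearMap.id ℝ ℂ).prod (mulCLM s)

/-- `graphDeriv s h = (h, h s)`. [folklore] -/
@[simp] theorem graphDeriv_apply (s h : ℂ) : graphDeriv s h = (h, h * s) := rfl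

/-- The **first density** of a `1`-form `β`: `β_q (1, σ)`, the `dx`-component of the pull-back
of `β` along a sheet of slope `σ`. [cite: GriffithsHarrisPrinciples1978, Ch. 0 §2] -/
def fstDensity (β : ℂ × ℂ → (ℂ × ℂ →L[ℝ] ℂ)) : ℂ × ℂ → ℂ → ℂ := fun q σ => β q (1, σ)

/-- The **second density** of a `1`-form `β`: `β_q (i, iσ)`, the `dy`-component of the pull-back
of `β` along a sheet of slope `σ`. [cite: GriffithsHarrisPrinciples1978, Ch. 0 §2] -/
def sndDensity (β : ℂ × ℂ → (ℂ × ℂ →L[ℝ] ℂ)) : ℂ × ℂ → ℂ → ℂ := fun q σ => β q (I, I * σ)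

/-- The **density of `dβ`** on the complex line of slope `σ` through `q`:
`dβ_q ((1, σ), (i, iσ)) = D β_q (1, σ) · (i, iσ) - D β_q (i, iσ) · (1, σ)`.
[cite: GriffithsHarrisPrinciples1978, Ch. 0 §2] -/
def dDensity (β : ℂ × ℂ → (ℂ × ℂ →L[ℝ] ℂ)) : ℂ × ℂ → ℂ → ℂ := fun q σ =>
  fderiv ℝ β q (1, σ) (I, I * σ) - fderiv ℝ β q (I, I * σ) (1, σ)

section Graph

variable {α : ℂ → ℂ} {D : Set ℂ} {β : ℂ × ℂ → (ℂ × ℂ →L[ℝ] ℂ)} {z : ℂ}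

/-- The graph map of a holomorphic function has real derivative `graphDeriv (α' z)`. [folklore] -/
theorem hasFDerivAt_graph (hD : IsOpen D) (hα : DifferentiableOn ℂ α D) (hz : z ∈ D) :
    HasFDerivAt (fun z => ((z, α z) : ℂ × ℂ)) (graphDeriv (deriv α z)) z := by
  have h1 : HasFDerivAt (fun z : ℂ => z) (ContinuousLinearMap.id ℝ ℂ) z := hasFDerivAt_id z
  have h2 : HasFDerivAt α (mulCLM (deriv α z)) z :=
    ((hα.differentiableAt (hD.mem_nhds hz)).hasDerivAt.hasFDerivAt.restrictScalars ℝ)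
  exact h1.prodMk h2

/-- The derivative of a holomorphic function is holomorphic (on an open set). [folklore] -/
theorem differentiableOn_deriv (hD : IsOpen D) (hα : DifferentiableOn ℂ α D) :
    DifferentiableOn ℂ (deriv α) D :=
  ((hα.analyticOnNhd hD).deriv).differentiableOn

/-- The slope vector `z ↦ (1, α' z)` has real derivative `h ↦ (0, h α''(z))`. [folklore] -/
theorem hasFDerivAt_one_deriv (hD : IsOpen D) (hα : DifferentiableOn ℂ α D) (hz : z ∈ D) :
    HasFDerivAt (fun z => (((1 : ℂ), deriv α z) : ℂ × ℂ))
      ((0 : ℂ →L[ℝ] ℂ).prod (mulCLM (deriv (deriv α) z))) z :=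
  (hasFDerivAt_const _ _).prodMk
    (((differentiableOn_deriv hD hα).differentiableAt (hD.mem_nhds hz)).hasDerivAt.hasFDerivAt
      |>.restrictScalars ℝ)

/-- The slope vector `z ↦ (i, i α' z)` has real derivative `h ↦ (0, h i α''(z))`. [folklore] -/
theorem hasFDerivAt_I_deriv (hD : IsOpen D) (hα : DifferentiableOn ℂ α D) (hz : z ∈ D) :
    HasFDerivAt (fun z => ((I, I * deriv α z) : ℂ × ℂ))
      ((0 : ℂ →L[ℝ] ℂ).prod (mulCLM (I * deriv (deriv α) z))) z := by
  refine (hasFDerivAt_const _ _).prodMk ?_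
  have h := ((differentiableOn_deriv hD hα).differentiableAt (hD.mem_nhds hz)).hasDerivAt.const_mul I
  exact h.hasFDerivAt.restrictScalars ℝ

variable (hD : IsOpen D) (hα : DifferentiableOn ℂ α D) (hβ : ContDiff ℝ 1 β) (hz : z ∈ D)
include hD hα hβ hz

/-- **Derivative of the first density along a graph**:
`D_h [β_{(z, α z)} (1, α' z)] = β (0, h α'') + (Dβ (h, h α')) (1, α')`.
[cite: GriffithsHarrisPrinciples1978, Ch. 0 §2] -/
theorem hasFDerivAt_fstDensity_graph :
    HasFDerivAt (fun z => β (z, α z) (1, deriv α z))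
      ((β (z, α z)).comp ((0 : ℂ →L[ℝ] ℂ).prod (mulCLM (deriv (deriv α) z))) +
        ((fderiv ℝ β (z, α z)).comp (graphDeriv (deriv α z))).flip (1, deriv α z)) z := by
  have hc : HasFDerivAt (fun z => β (z, α z)) ((fderiv ℝ β (z, α z)).comp (graphDeriv (deriv α z))) z :=
    ((hβ.differentiable one_ne_zero) _).hasFDerivAt.comp z (hasFDerivAt_graph hD hα hz)
  exact hc.clm_apply (hasFDerivAt_one_deriv hD hα hz)

/-- **Derivative of the second density along a graph**:
`D_h [β_{(z, α z)} (i, i α' z)] = β (0, h i α'') + (Dβ (h, h α')) (i, i α')`.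
[cite: GriffithsHarrisPrinciples1978, Ch. 0 §2] -/
theorem hasFDerivAt_sndDensity_graph :
    HasFDerivAt (fun z => β (z, α z) (I, I * deriv α z))
      ((β (z, α z)).comp ((0 : ℂ →L[ℝ] ℂ).prod (mulCLM (I * deriv (deriv α) z))) +
        ((fderiv ℝ β (z, α z)).comp (graphDeriv (deriv α z))).flip (I, I * deriv α z)) z := by
  have hc : HasFDerivAt (fun z => β (z, α z)) ((fderiv ℝ β (z, α z)).comp (graphDeriv (deriv α z))) z :=
    ((hβ.differentiable one_ne_zero) _).hasFDerivAt.comp z (hasFDerivAt_graph hD hα hz)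
  exact hc.clm_apply (hasFDerivAt_I_deriv hD hα hz)

/-- **The second derivatives of the sheet cancel**: along a holomorphic graph,
`∂₁ [β (i, iα')] - ∂_i [β (1, α')] = dβ ((1, α'), (i, iα'))`, the density of `dβ`.
[cite: GriffithsHarrisPrinciples1978, Ch. 0 §2] -/
theorem fderiv_sndDensity_sub_fderiv_fstDensity :
    fderiv ℝ (fun z => β (z, α z) (I, I * deriv α z)) z 1 -
      fderiv ℝ (fun z => β (z, α z) (1, deriv α z)) z I = dDensity β (z, α z) (deriv α z) := by
  rw [(hasFDerivAt_sndDensity_graph hD hα hβ hz).fderiv, (hasFDerivAt_fstDensity_graph hD hα hβ hz).fderiv]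
  simp only [add_apply, ContinuousLinearMap.comp_apply,
    ContinuousLinearMap.flip_apply, ContinuousLinearMap.prod_apply, zero_apply,
    mulCLM_apply, graphDeriv_apply, one_mul, dDensity]
  ring

end Graph

/-! ### Support, continuity and growth of the densities -/

section Densities

variable {β : ℂ × ℂ → (ℂ × ℂ →L[ℝ] ℂ)}

/-- The first density is supported in the support of the form. [folklore] -/
theorem suppIn_fstDensity (β : ℂ × ℂ → (ℂ × ℂ →L[ℝ] ℂ)) : SuppIn (fstDensity β) (tsupport β) :=
  fun q hq σ => by simp [fstDensity, image_eq_zero_of_notMem_tsupport hq]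

/-- The second density is supported in the support of the form. [folklore] -/
theorem suppIn_sndDensity (β : ℂ × ℂ → (ℂ × ℂ →L[ℝ] ℂ)) : SuppIn (sndDensity β) (tsupport β) :=
  fun q hq σ => by simp [sndDensity, image_eq_zero_of_notMem_tsupport hq]

/-- The density of `dβ` is supported in the support of the form. [folklore] -/
theorem suppIn_dDensity (β : ℂ × ℂ → (ℂ × ℂ →L[ℝ] ℂ)) : SuppIn (dDensity β) (tsupport β) :=
  fun q hq σ => by simp [dDensity, fderiv_of_notMem_tsupport ℝ hq]

/-- **The density of `dβ` through scalar derivatives**: `dβ_q (u, v) = D_u [β(·) v] - D_v [β(·) u]`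
(evaluation at a fixed vector commutes with the derivative). [folklore] -/
theorem dDensity_eq_fderiv_apply {q : ℂ × ℂ} (hβ : DifferentiableAt ℝ β q) (σ : ℂ) :
    dDensity β q σ = fderiv ℝ (fun q => β q (I, I * σ)) q (1, σ) -
      fderiv ℝ (fun q => β q (1, σ)) q (I, I * σ) := by
  rw [fderiv_clm_apply hβ (differentiableAt_const _), fderiv_clm_apply hβ (differentiableAt_const _)]
  simp [dDensity]

/-- Joint continuity of the first density. [folklore] -/
theorem continuous_fstDensity (hβ : Continuous β) : Continuous (Function.uncurry (fstDensity β)) := by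
  refine Continuous.clm_apply (hβ.comp continuous_fst) ?_
  exact continuous_const.prodMk continuous_snd

/-- Joint continuity of the second density. [folklore] -/
theorem continuous_sndDensity (hβ : Continuous β) : Continuous (Function.uncurry (sndDensity β)) := by
  refine Continuous.clm_apply (hβ.comp continuous_fst) ?_
  exact continuous_const.prodMk (continuous_const.mul continuous_snd)

/-- Joint continuity of the density of `dβ` for a `C¹` form. [folklore] -/
theorem continuous_dDensity (hβ : ContDiff ℝ 1 β) : Continuous (Function.uncurry (dDensity β)) := by
  have hd : Continuous (fderiv ℝ β) := hβ.continuous_fderiv one_ne_zero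
  refine Continuous.sub ?_ ?_
  · refine Continuous.clm_apply (Continuous.clm_apply (hd.comp continuous_fst) ?_) ?_
    · exact continuous_const.prodMk continuous_snd
    · exact continuous_const.prodMk (continuous_const.mul continuous_snd)
  · refine Continuous.clm_apply (Continuous.clm_apply (hd.comp continuous_fst) ?_) ?_
    · exact continuous_const.prodMk (continuous_const.mul continuous_snd)
    · exact continuous_const.prodMk continuous_snd

/-- Norm of the slope vector `(1, σ)`. [folklore] -/
theorem norm_one_slope_le (σ : ℂ) : ‖((1 : ℂ), σ)‖ ≤ 1 + ‖σ‖ := by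
  rw [Prod.norm_def]
  exact max_le (by simp) (by linarith [norm_nonneg σ])

/-- Norm of the slope vector `(i, iσ)`. [folklore] -/
theorem norm_I_slope_le (σ : ℂ) : ‖((I : ℂ), I * σ)‖ ≤ 1 + ‖σ‖ := by
  rw [Prod.norm_def]
  refine max_le (by simp) ?_
  rw [norm_mul, Complex.norm_I, one_mul]
  linarith [norm_nonneg σ]

/-- **Linear growth of the first density** in the slope, for a bounded form. [folklore] -/
theorem norm_fstDensity_le {C : ℝ} (hC : ∀ q, ‖β q‖ ≤ C) (q : ℂ × ℂ) (σ : ℂ) :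
    ‖fstDensity β q σ‖ ≤ C * (1 + ‖σ‖) :=
  calc ‖fstDensity β q σ‖ = ‖β q (1, σ)‖ := rfl
    _ ≤ ‖β q‖ * ‖((1 : ℂ), σ)‖ := (β q).le_opNorm _
    _ ≤ C * (1 + ‖σ‖) := mul_le_mul (hC q) (norm_one_slope_le σ) (norm_nonneg _)
        ((norm_nonneg _).trans (hC q))

/-- **Linear growth of the second density** in the slope, for a bounded form. [folklore] -/
theorem norm_sndDensity_le {C : ℝ} (hC : ∀ q, ‖β q‖ ≤ C) (q : ℂ × ℂ) (σ : ℂ) :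
    ‖sndDensity β q σ‖ ≤ C * (1 + ‖σ‖) :=
  calc ‖sndDensity β q σ‖ = ‖β q (I, I * σ)‖ := rfl
    _ ≤ ‖β q‖ * ‖((I : ℂ), I * σ)‖ := (β q).le_opNorm _
    _ ≤ C * (1 + ‖σ‖) := mul_le_mul (hC q) (norm_I_slope_le σ) (norm_nonneg _)
        ((norm_nonneg _).trans (hC q))

/-- **Quadratic growth of the density of `dβ`** in the slope, for a form with bounded
derivative (bound in the bilinear form `‖Dβ_q u · v‖ ≤ C ‖u‖ ‖v‖`). [folklore] -/
theorem norm_dDensity_le {C : ℝ} (hC0 : 0 ≤ C) (hC : ∀ q u v, ‖fderiv ℝ β q u v‖ ≤ C * ‖u‖ * ‖v‖)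
    (q : ℂ × ℂ) (σ : ℂ) : ‖dDensity β q σ‖ ≤ 4 * C * (1 + ‖σ‖ ^ 2) := by
  have h1 := norm_one_slope_le σ
  have h2 := norm_I_slope_le σ
  calc ‖dDensity β q σ‖ ≤ ‖fderiv ℝ β q (1, σ) (I, I * σ)‖ + ‖fderiv ℝ β q (I, I * σ) (1, σ)‖ :=
        norm_sub_le _ _
    _ ≤ C * ‖((1 : ℂ), σ)‖ * ‖((I : ℂ), I * σ)‖ + C * ‖((I : ℂ), I * σ)‖ * ‖((1 : ℂ), σ)‖ :=
        add_le_add (hC _ _ _) (hC _ _ _)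
    _ ≤ C * (1 + ‖σ‖) * (1 + ‖σ‖) + C * (1 + ‖σ‖) * (1 + ‖σ‖) := by gcongr
    _ ≤ 4 * C * (1 + ‖σ‖ ^ 2) := by nlinarith [sq_nonneg (1 - ‖σ‖), norm_nonneg σ]

/-- **A bound for a compactly supported `1`-form.** [folklore] -/
theorem exists_bound_of_hasCompactSupport (hβ : Continuous β) (hβc : HasCompactSupport β) :
    ∃ C : ℝ, 0 ≤ C ∧ ∀ q, ‖β q‖ ≤ C := by
  obtain ⟨C, hC⟩ := hβc.exists_bound_of_continuous hβ
  exact ⟨max C 0, le_max_right _ _, fun q => (hC q).trans (le_max_left _ _)⟩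

/-- **A bilinear bound for the derivative of a compactly supported `C¹` `1`-form**:
`‖Dβ_q u · v‖ ≤ C ‖u‖ ‖v‖` (compactness of the support times the unit spheres; stated through the
scalar evaluations to stay clear of operator-norm topologies). [folklore] -/
theorem exists_bound_fderiv_apply₂ (hβ : ContDiff ℝ 1 β) (hβc : HasCompactSupport β) :
    ∃ C : ℝ, 0 ≤ C ∧ ∀ q u v, ‖fderiv ℝ β q u v‖ ≤ C * ‖u‖ * ‖v‖ := by
  -- joint continuity of `(q, u, v) ↦ Dβ_q u v`
  have h1 : Continuous fun x : (ℂ × ℂ) × (ℂ × ℂ) => fderiv ℝ β x.1 x.2 :=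
    hβ.continuous_fderiv_apply one_ne_zero
  have h2 : Continuous fun x : ((ℂ × ℂ) × (ℂ × ℂ)) × (ℂ × ℂ) => fderiv ℝ β x.1.1 x.1.2 x.2 :=
    (h1.comp continuous_fst).clm_apply continuous_snd
  -- bound on the compact set `tsupport β × B̄ × B̄`
  set K : Set (((ℂ × ℂ) × (ℂ × ℂ)) × (ℂ × ℂ)) :=
    (tsupport β ×ˢ closedBall (0 : ℂ × ℂ) 1) ×ˢ closedBall (0 : ℂ × ℂ) 1 with hK
  have hKc : IsCompact K :=
    (hβc.isCompact.prod (isCompact_closedBall _ _)).prod (isCompact_closedBall _ _)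
  obtain ⟨C, hC⟩ := hKc.exists_bound_of_continuousOn h2.continuousOn
  refine ⟨max C 0, le_max_right _ _, fun q u v => ?_⟩
  by_cases hq : q ∈ tsupport β
  swap
  · rw [fderiv_of_notMem_tsupport ℝ hq]; simp; positivity
  -- scale `u`, `v` to the unit ball
  by_cases hu : u = 0
  · subst hu; simp
  by_cases hv : v = 0
  · subst hv; simp
  have hu0 : 0 < ‖u‖ := norm_pos_iff.2 hu
  have hv0 : 0 < ‖v‖ := norm_pos_iff.2 hv
  have hu₁n : ‖(‖u‖⁻¹ : ℝ) • u‖ ≤ 1 := by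
    rw [norm_smul, Real.norm_eq_abs, abs_inv, abs_norm, inv_mul_cancel₀ hu0.ne']
  have hv₁n : ‖(‖v‖⁻¹ : ℝ) • v‖ ≤ 1 := by
    rw [norm_smul, Real.norm_eq_abs, abs_inv, abs_norm, inv_mul_cancel₀ hv0.ne']
  have hmem : ((q, (‖u‖⁻¹ : ℝ) • u), (‖v‖⁻¹ : ℝ) • v) ∈ K :=
    ⟨⟨hq, mem_closedBall_zero_iff.2 hu₁n⟩, mem_closedBall_zero_iff.2 hv₁n⟩
  have hb : ‖fderiv ℝ β q ((‖u‖⁻¹ : ℝ) • u) ((‖v‖⁻¹ : ℝ) • v)‖ ≤ C := by simpa using hC _ hmem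
  have hlin : fderiv ℝ β q u v = ((‖u‖ * ‖v‖ : ℝ)) • fderiv ℝ β q ((‖u‖⁻¹ : ℝ) • u) ((‖v‖⁻¹ : ℝ) • v) := by
    rw [map_smul, map_smul, FunLike.coe_smul, Pi.smul_apply, smul_smul, smul_smul]
    rw [show ‖u‖ * ‖v‖ * ‖v‖⁻¹ * ‖u‖⁻¹ = 1 by field_simp, one_smul]
  calc ‖fderiv ℝ β q u v‖ = ‖u‖ * ‖v‖ * ‖fderiv ℝ β q ((‖u‖⁻¹ : ℝ) • u) ((‖v‖⁻¹ : ℝ) • v)‖ := by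
        rw [hlin, norm_smul, Real.norm_eq_abs, abs_of_pos (mul_pos hu0 hv0)]
    _ ≤ ‖u‖ * ‖v‖ * C := by gcongr
    _ ≤ max C 0 * ‖u‖ * ‖v‖ := by nlinarith [le_max_left C 0, mul_nonneg hu0.le hv0.le]

end Densities

/-! ### The pulled-back form on the base disc: regularity off the discriminant -/

namespace ZBox

variable (B : ZBox Z) {β : ℂ × ℂ → (ℂ × ℂ →L[ℝ] ℂ)}

/-- **The pulled-back form is `C¹` on the good set, with `∂₁ Q - ∂_i P = sheetSum (dDensity β)`.**
For a `C¹` form supported in the box and a good point `z`, the sheet sums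
`P = sheetSum Z (fstDensity β)`, `Q = sheetSum Z (sndDensity β)` are differentiable at `z` and
`(fderiv Q z) 1 - (fderiv P z) i = sheetSum Z (dDensity β) z`.
[cite: GriffithsHarrisPrinciples1978, Ch. 0 §2] -/
theorem differentiableAt_sheetSum_of_mem_good (hβ : ContDiff ℝ 1 β) (hβB : tsupport β ⊆ B.box)
    {z : ℂ} (hz : z ∈ B.good) :
    DifferentiableAt ℝ (sheetSum Z (fstDensity β)) z ∧
    DifferentiableAt ℝ (sheetSum Z (sndDensity β)) z ∧
    fderiv ℝ (sheetSum Z (sndDensity β)) z 1 - fderiv ℝ (sheetSum Z (fstDensity β)) z I =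
      sheetSum Z (dDensity β) z := by
  set S := B.sheets hz
  have hP : SuppIn (fstDensity β) B.box := (suppIn_fstDensity β).mono hβB
  have hQ : SuppIn (sndDensity β) B.box := (suppIn_sndDensity β).mono hβB
  have hH : SuppIn (dDensity β) B.box := (suppIn_dDensity β).mono hβB
  have hzδ : z ∈ ball z S.δ := mem_ball_self S.δ_pos
  -- local representations over the sheets
  have hPev : sheetSum Z (fstDensity β) =ᶠ[𝓝 z] fun y => ∑ i, β (y, S.β i y) (1, deriv (S.β i) y) :=
    Filter.eventually_of_mem (ball_mem_nhds z S.δ_pos) fun y hy => B.sheetSum_eq_sum_sheets hP S hy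
  have hQev : sheetSum Z (sndDensity β) =ᶠ[𝓝 z] fun y => ∑ i, β (y, S.β i y) (I, I * deriv (S.β i) y) :=
    Filter.eventually_of_mem (ball_mem_nhds z S.δ_pos) fun y hy => B.sheetSum_eq_sum_sheets hQ S hy
  have hPd : HasFDerivAt (sheetSum Z (fstDensity β))
      (∑ i, ((β (z, S.β i z)).comp ((0 : ℂ →L[ℝ] ℂ).prod (mulCLM (deriv (deriv (S.β i)) z))) +
        ((fderiv ℝ β (z, S.β i z)).comp (graphDeriv (deriv (S.β i) z))).flip (1, deriv (S.β i) z))) z := by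
    refine HasFDerivAt.congr_of_eventuallyEq ?_ hPev
    exact HasFDerivAt.fun_sum fun i _ =>
      hasFDerivAt_fstDensity_graph isOpen_ball (S.differentiableOn i) hβ hzδ
  have hQd : HasFDerivAt (sheetSum Z (sndDensity β))
      (∑ i, ((β (z, S.β i z)).comp ((0 : ℂ →L[ℝ] ℂ).prod (mulCLM (I * deriv (deriv (S.β i)) z))) +
        ((fderiv ℝ β (z, S.β i z)).comp (graphDeriv (deriv (S.β i) z))).flip (I, I * deriv (S.β i) z))) z := by
    refine HasFDerivAt.congr_of_eventuallyEq ?_ hQev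
    exact HasFDerivAt.fun_sum fun i _ =>
      hasFDerivAt_sndDensity_graph isOpen_ball (S.differentiableOn i) hβ hzδ
  refine ⟨hPd.differentiableAt, hQd.differentiableAt, ?_⟩
  rw [hPd.fderiv, hQd.fderiv, B.sheetSum_eq_sum_sheets hH S hzδ, _root_.sum_apply, _root_.sum_apply,
    ← Finset.sum_sub_distrib]
  refine Finset.sum_congr rfl fun i _ => ?_
  rw [← (hasFDerivAt_sndDensity_graph isOpen_ball (S.differentiableOn i) hβ hzδ).fderiv,
    ← (hasFDerivAt_fstDensity_graph isOpen_ball (S.differentiableOn i) hβ hzδ).fderiv]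
  exact fderiv_sndDensity_sub_fderiv_fstDensity isOpen_ball (S.differentiableOn i) hβ hzδ

/-- **The singular set**: the points of the base disc under the support of `β` at which the
discriminant vanishes. [cite: Chirka1989, §1.3] -/
def sing (β : ℂ × ℂ → (ℂ × ℂ →L[ℝ] ℂ)) : Set ℂ := (Prod.fst '' tsupport β) ∩ (B.base \ B.good)

/-- The zero set of the discriminant is discrete in the base disc. [cite: Chirka1989, §1.3] -/
theorem isDiscrete_base_diff_good : IsDiscrete (B.base \ B.good) := by
  have han : AnalyticOnNhd ℂ B.disc B.base := B.differentiableOn_disc.analyticOnNhd isOpen_ball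
  have heq : B.base \ B.good = {z | B.disc z = 0} ∩ B.base := by
    ext z
    simp only [ZBox.good, Set.mem_sdiff, mem_setOf_eq, mem_inter_iff, not_and, not_not]
    tauto
  rw [heq]
  rcases han.eqOn_zero_or_eventually_ne_zero_of_preconnected B.isPreconnected_base with h | h
  · obtain ⟨z, hz, hne⟩ := B.exists_disc_ne_zero
    exact absurd (h hz) hne
  · refine isDiscrete_of_codiscreteWithin ?_
    rw [compl_setOf]
    exact h

/-- **The singular set is finite** (for a compactly supported form supported in the box): it is
compact and discrete. [cite: Chirka1989, §1.3] -/
theorem sing_finite (hβc : HasCompactSupport β) (hβB : tsupport β ⊆ B.box) : (B.sing β).Finite := by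
  have hK₁ : IsCompact (Prod.fst '' tsupport β) := hβc.image continuous_fst
  have hK₁b : Prod.fst '' tsupport β ⊆ B.base := by
    rintro _ ⟨q, hq, rfl⟩; exact (hβB hq).1
  -- `sing = K₁ ∩ disc⁻¹ {0}`, closed in the compact `K₁`
  have heq : B.sing β = (Prod.fst '' tsupport β) ∩ B.disc ⁻¹' {0} := by
    ext z
    simp only [sing, mem_inter_iff, Set.mem_sdiff, ZBox.good, mem_setOf_eq, mem_preimage,
      mem_singleton_iff, not_and, not_not]
    constructor
    · rintro ⟨hz, hzb, h⟩; exact ⟨hz, h hzb⟩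
    · rintro ⟨hz, h⟩; exact ⟨hz, hK₁b hz, fun _ => h⟩
  have hcl : IsClosed (B.sing β) := by
    rw [heq]
    exact (B.differentiableOn_disc.continuousOn.mono hK₁b).preimage_isClosed_of_isClosed
      hK₁.isClosed isClosed_singleton
  have hcpt : IsCompact (B.sing β) := hK₁.of_isClosed_subset hcl inter_subset_left
  exact hcpt.finite (B.isDiscrete_base_diff_good.mono inter_subset_right)

/-- **Regularity of the pulled-back form off the singular set.** For a `C¹` form with compact
support in the box and `z ∉ sing`, the sheet sums `P`, `Q` are differentiable at `z` with
`(fderiv Q z) 1 - (fderiv P z) i = sheetSum Z (dDensity β) z`: over good points by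
`differentiableAt_sheetSum_of_mem_good`, and away from the `z`-projection of the support all three
sheet sums vanish identically near `z`. [cite: GriffithsHarrisPrinciples1978, Ch. 0 §2] -/
theorem differentiableAt_sheetSum_of_notMem_sing (hβ : ContDiff ℝ 1 β) (hβc : HasCompactSupport β)
    (hβB : tsupport β ⊆ B.box) {z : ℂ} (hz : z ∉ B.sing β) :
    DifferentiableAt ℝ (sheetSum Z (fstDensity β)) z ∧
    DifferentiableAt ℝ (sheetSum Z (sndDensity β)) z ∧
    fderiv ℝ (sheetSum Z (sndDensity β)) z 1 - fderiv ℝ (sheetSum Z (fstDensity β)) z I =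
      sheetSum Z (dDensity β) z := by
  by_cases hzK : z ∈ Prod.fst '' tsupport β
  · -- then `z` is a good point
    have hzb : z ∈ B.base := by obtain ⟨q, hq, rfl⟩ := hzK; exact (hβB hq).1
    have hzg : z ∈ B.good := by
      by_contra hzg
      exact hz ⟨hzK, hzb, hzg⟩
    exact B.differentiableAt_sheetSum_of_mem_good hβ hβB hzg
  · -- near `z`, all three sheet sums vanish
    have hK₁c : IsClosed (Prod.fst '' tsupport β) := (hβc.image continuous_fst).isClosed
    have hev : ∀ᶠ y in 𝓝 z, y ∉ Prod.fst '' tsupport β := hK₁c.isOpen_compl.mem_nhds hzK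
    have hvan : ∀ (g : ℂ × ℂ → ℂ → ℂ), SuppIn g (tsupport β) → ∀ y, y ∉ Prod.fst '' tsupport β →
        sheetSum Z g y = 0 := by
      intro g hg y hy
      refine finsum_mem_eq_zero_of_forall_eq_zero fun w _ => hg (y, w) (fun hq => hy ⟨_, hq, rfl⟩) _
    have hP0 : sheetSum Z (fstDensity β) =ᶠ[𝓝 z] fun _ => 0 :=
      hev.mono fun y hy => hvan _ (suppIn_fstDensity β) y hy
    have hQ0 : sheetSum Z (sndDensity β) =ᶠ[𝓝 z] fun _ => 0 :=
      hev.mono fun y hy => hvan _ (suppIn_sndDensity β) y hy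
    have hPd : HasFDerivAt (sheetSum Z (fstDensity β)) (0 : ℂ →L[ℝ] ℂ) z :=
      (hasFDerivAt_const (0 : ℂ) z).congr_of_eventuallyEq hP0
    have hQd : HasFDerivAt (sheetSum Z (sndDensity β)) (0 : ℂ →L[ℝ] ℂ) z :=
      (hasFDerivAt_const (0 : ℂ) z).congr_of_eventuallyEq hQ0
    refine ⟨hPd.differentiableAt, hQd.differentiableAt, ?_⟩
    rw [hPd.fderiv, hQd.fderiv, hvan _ (suppIn_dDensity β) z hzK]
    simp

end ZBox


/-! ### `C¹` regularity of the pulled-back form off the singular set -/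

namespace ZBox

variable (B : ZBox Z) {β : ℂ × ℂ → (ℂ × ℂ →L[ℝ] ℂ)}

/-- Along a holomorphic graph, `z ↦ β (z, α z) (v z)` is `C¹` for a `C¹` form and a `C^∞` slope
vector `v`. [folklore] -/
theorem contDiffAt_apply_graph {α : ℂ → ℂ} {D : Set ℂ} (hD : IsOpen D) (hα : DifferentiableOn ℂ α D)
    (hβ : ContDiff ℝ 1 β) {v : ℂ → ℂ × ℂ} {z : ℂ} (hz : z ∈ D) (hv : ContDiffAt ℝ 1 v z) :
    ContDiffAt ℝ 1 (fun z => β (z, α z) (v z)) z := by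
  have hαC : ContDiffAt ℝ 1 α z :=
    ((hα.analyticAt (hD.mem_nhds hz)).contDiffAt (n := 1)).restrict_scalars ℝ
  have hg : ContDiffAt ℝ 1 (fun z => ((z, α z) : ℂ × ℂ)) z := contDiffAt_id.prodMk hαC
  exact (hβ.contDiffAt.comp z hg).clm_apply hv

/-- The derivative of a holomorphic function is `C^∞` (real sense) at interior points. [folklore] -/
theorem contDiffAt_deriv {α : ℂ → ℂ} {D : Set ℂ} (hD : IsOpen D) (hα : DifferentiableOn ℂ α D)
    {z : ℂ} (hz : z ∈ D) {n : WithTop ℕ∞} : ContDiffAt ℝ n (deriv α) z :=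
  (((differentiableOn_deriv hD hα).analyticAt (hD.mem_nhds hz)).contDiffAt).restrict_scalars ℝ

/-- **The pulled-back form is `C¹` off the singular set.** [cite: GriffithsHarrisPrinciples1978, Ch. 0 §2] -/
theorem contDiffAt_sheetSum_of_notMem_sing (hβ : ContDiff ℝ 1 β) (hβc : HasCompactSupport β)
    (hβB : tsupport β ⊆ B.box) {z : ℂ} (hz : z ∉ B.sing β) :
    ContDiffAt ℝ 1 (sheetSum Z (fstDensity β)) z ∧ ContDiffAt ℝ 1 (sheetSum Z (sndDensity β)) z := by
  have hP : SuppIn (fstDensity β) B.box := (suppIn_fstDensity β).mono hβB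
  have hQ : SuppIn (sndDensity β) B.box := (suppIn_sndDensity β).mono hβB
  by_cases hzK : z ∈ Prod.fst '' tsupport β
  · have hzb : z ∈ B.base := by obtain ⟨q, hq, rfl⟩ := hzK; exact (hβB hq).1
    have hzg : z ∈ B.good := by
      by_contra hzg
      exact hz ⟨hzK, hzb, hzg⟩
    set S := B.sheets hzg
    have hzδ : z ∈ ball z S.δ := mem_ball_self S.δ_pos
    have hPev : sheetSum Z (fstDensity β) =ᶠ[𝓝 z] fun y => ∑ i, β (y, S.β i y) (1, deriv (S.β i) y) :=
      Filter.eventually_of_mem (ball_mem_nhds z S.δ_pos) fun y hy => B.sheetSum_eq_sum_sheets hP S hy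
    have hQev : sheetSum Z (sndDensity β) =ᶠ[𝓝 z] fun y => ∑ i, β (y, S.β i y) (I, I * deriv (S.β i) y) :=
      Filter.eventually_of_mem (ball_mem_nhds z S.δ_pos) fun y hy => B.sheetSum_eq_sum_sheets hQ S hy
    constructor
    · refine ContDiffAt.congr_of_eventuallyEq ?_ hPev
      refine ContDiffAt.sum fun i _ => ?_
      exact contDiffAt_apply_graph isOpen_ball (S.differentiableOn i) hβ hzδ
        (contDiffAt_const.prodMk (contDiffAt_deriv isOpen_ball (S.differentiableOn i) hzδ))
    · refine ContDiffAt.congr_of_eventuallyEq ?_ hQev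
      refine ContDiffAt.sum fun i _ => ?_
      exact contDiffAt_apply_graph isOpen_ball (S.differentiableOn i) hβ hzδ
        (contDiffAt_const.prodMk (contDiffAt_const.mul
          (contDiffAt_deriv isOpen_ball (S.differentiableOn i) hzδ)))
  · have hK₁c : IsClosed (Prod.fst '' tsupport β) := (hβc.image continuous_fst).isClosed
    have hev : ∀ᶠ y in 𝓝 z, y ∉ Prod.fst '' tsupport β := hK₁c.isOpen_compl.mem_nhds hzK
    have hvan : ∀ (g : ℂ × ℂ → ℂ → ℂ), SuppIn g (tsupport β) → ∀ y, y ∉ Prod.fst '' tsupport β →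
        sheetSum Z g y = 0 := fun g hg y hy =>
      finsum_mem_eq_zero_of_forall_eq_zero fun w _ => hg (y, w) (fun hq => hy ⟨_, hq, rfl⟩) _
    constructor
    · exact (contDiffAt_const (c := (0 : ℂ))).congr_of_eventuallyEq
        (hev.mono fun y hy => hvan _ (suppIn_fstDensity β) y hy)
    · exact (contDiffAt_const (c := (0 : ℂ))).congr_of_eventuallyEq
        (hev.mono fun y hy => hvan _ (suppIn_sndDensity β) y hy)

end ZBox

/-! ### `∫ ∂f = 0` for compactly supported `C¹` functions on `ℂ` -/

/-- **The integral of a derivative of a compactly supported `C¹` function vanishes**: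
`∫ D_v f = 0` for `f : ℂ → ℂ` of class `C¹` with compact support (integration by parts against a
bump equal to `1` near the support, `integral_mul_fderiv_eq_neg_fderiv_mul_of_integrable`).
[folklore] -/
theorem integral_fderiv_apply_eq_zero {f : ℂ → ℂ} (hf : ContDiff ℝ 1 f) (hfc : HasCompactSupport f)
    (v : ℂ) : ∫ z, fderiv ℝ f z v = 0 := by
  -- a bump `τ ≡ 1` on a neighbourhood of the support
  obtain ⟨R, hR⟩ : ∃ R : ℝ, tsupport f ⊆ closedBall (0 : ℂ) R :=
    (isBounded_iff_subset_closedBall 0).1 hfc.isCompact.isBounded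
  set R' := max R 0 with hR'
  have hsub : tsupport f ⊆ ball (0 : ℂ) (R' + 1) := hR.trans
    ((closedBall_subset_closedBall (le_max_left _ _)).trans (closedBall_subset_ball (by linarith)))
  let b : ContDiffBump (0 : ℂ) := ⟨R' + 1, R' + 2, by positivity, by linarith⟩
  set τ : ℂ → ℂ := fun z => ((b z : ℝ) : ℂ) with hτ
  have hτd : ContDiff ℝ 1 τ := ofRealCLM.contDiff.comp (b.contDiff (n := 1))
  have hτ1 : ∀ z ∈ ball (0 : ℂ) (R' + 1), τ =ᶠ[𝓝 z] fun _ => 1 := by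
    intro z hz
    filter_upwards [b.eventuallyEq_one_of_mem_ball hz] with y hy
    simp [hτ, hy]
  -- integration by parts `∫ τ ∂f = -∫ ∂τ f`
  have hfd : Differentiable ℝ f := hf.differentiable one_ne_zero
  have hfcont : Continuous f := hf.continuous
  have hf'c : Continuous fun z => fderiv ℝ f z v := (hf.continuous_fderiv one_ne_zero).clm_apply continuous_const
  have hf'supp : HasCompactSupport fun z => fderiv ℝ f z v := hfc.fderiv_apply (𝕜 := ℝ) v
  have h1 : (fun z => τ z * fderiv ℝ f z v) = fun z => fderiv ℝ f z v := by
    funext z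
    by_cases hz : z ∈ tsupport f
    · rw [(hτ1 z (hsub hz)).self_of_nhds, one_mul]
    · rw [fderiv_of_notMem_tsupport ℝ hz]; simp
  have h2 : (fun z => fderiv ℝ τ z v * f z) = fun _ => 0 := by
    funext z
    by_cases hz : z ∈ tsupport f
    · rw [(hτ1 z (hsub hz)).fderiv_eq]; simp
    · rw [image_eq_zero_of_notMem_tsupport hz, mul_zero]
  have hibp := integral_mul_fderiv_eq_neg_fderiv_mul_of_integrable (μ := volume) (f := τ) (g := f)
    (v := v) ?_ ?_ ?_ (fun z _ => hτd.differentiable one_ne_zero z) (fun z _ => hfd z)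
  · rw [h1, h2] at hibp
    simpa using hibp
  · rw [h2]; exact integrable_zero _ _ _
  · rw [h1]; exact hf'c.integrable_of_hasCompactSupport hf'supp
  · exact (hτd.continuous.mul hfcont).integrable_of_hasCompactSupport (hfc.mul_left)

/-! ### Smooth cutoffs around finitely many points -/

/-- The standard bump on `ℂ`: `1` on the closed unit disc, supported in the disc of radius `2`.
[folklore] -/
def stdBump : ContDiffBump (0 : ℂ) := ⟨1, 2, one_pos, one_lt_two⟩

/-- The bump of scale `ε` at `p`: `z ↦ stdBump (ε⁻¹ (z - p))`, equal to `1` on `closedBall p ε`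
and supported in `ball p (2ε)`. [folklore] -/
def bumpAt (p : ℂ) (ε : ℝ) (z : ℂ) : ℝ := stdBump (ε⁻¹ • (z - p))

/-- **The cutoff** `ψ = 1 - Σ_{p ∈ T} bumpAt p ε`: for `4ε`-separated `T`, a smooth function with
values in `[0, 1]`, vanishing on the `ε`-discs around `T` and equal to `1` off the `2ε`-discs.
[folklore] -/
def cutoff (T : Finset ℂ) (ε : ℝ) (z : ℂ) : ℝ := 1 - ∑ p ∈ T, bumpAt p ε z

section Cutoff

variable {T : Finset ℂ} {ε : ℝ} {p z : ℂ}

/-- Smoothness of the scaled bump. [folklore] -/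
theorem contDiff_bumpAt (p : ℂ) (ε : ℝ) {n : ℕ∞} : ContDiff ℝ n (bumpAt p ε) :=
  (stdBump.contDiff (n := n)).comp ((contDiff_id.sub contDiff_const).const_smul _)

/-- Smoothness of the cutoff. [folklore] -/
theorem contDiff_cutoff (T : Finset ℂ) (ε : ℝ) {n : ℕ∞} : ContDiff ℝ n (cutoff T ε) :=
  contDiff_const.sub (ContDiff.sum fun p _ => contDiff_bumpAt p ε)

/-- The scaled bump is `1` on `closedBall p ε`. [folklore] -/
theorem bumpAt_eq_one (hε : 0 < ε) (hz : dist z p ≤ ε) : bumpAt p ε z = 1 := by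
  refine stdBump.one_of_mem_closedBall ?_
  rw [mem_closedBall, dist_zero_right, norm_smul, Real.norm_eq_abs, abs_inv, abs_of_pos hε,
    ← dist_eq_norm, show (stdBump).rIn = 1 from rfl]
  rwa [inv_mul_le_iff₀ hε, mul_one]

/-- The scaled bump vanishes off `ball p (2ε)`. [folklore] -/
theorem bumpAt_eq_zero (hε : 0 < ε) (hz : 2 * ε ≤ dist z p) : bumpAt p ε z = 0 := by
  refine stdBump.zero_of_le_dist ?_
  rw [dist_zero_right, norm_smul, Real.norm_eq_abs, abs_inv, abs_of_pos hε, ← dist_eq_norm,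
    show (stdBump).rOut = 2 from rfl]
  rw [le_inv_mul_iff₀ hε]
  linarith

/-- The scaled bump takes values in `[0, 1]`. [folklore] -/
theorem bumpAt_nonneg : 0 ≤ bumpAt p ε z := stdBump.nonneg

/-- The scaled bump takes values in `[0, 1]`. [folklore] -/
theorem bumpAt_le_one : bumpAt p ε z ≤ 1 := stdBump.le_one

/-- The support of the scaled bump lies in `closedBall p (2ε)`. [folklore] -/
theorem tsupport_bumpAt_subset (hε : 0 < ε) : tsupport (bumpAt p ε) ⊆ closedBall p (2 * ε) := by
  refine closure_minimal (fun z hz => ?_) isClosed_closedBall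
  rw [mem_closedBall]
  by_contra h
  exact hz (bumpAt_eq_zero hε (le_of_lt (not_le.1 h)))

/-- A bound for the derivative of the standard bump. [folklore] -/
theorem exists_bound_fderiv_stdBump : ∃ M : ℝ, 0 ≤ M ∧ ∀ x : ℂ, ‖fderiv ℝ (stdBump : ℂ → ℝ) x‖ ≤ M := by
  obtain ⟨M, hM⟩ := (stdBump.hasCompactSupport.fderiv (𝕜 := ℝ)).exists_bound_of_continuous
    (stdBump.contDiff.continuous_fderiv (by simp : ((⊤ : ℕ∞) : WithTop ℕ∞) ≠ 0))
  exact ⟨max M 0, le_max_right _ _, fun x => (hM x).trans (le_max_left _ _)⟩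

/-- **Derivative bound for the scaled bump**: `‖D (bumpAt p ε) z‖ ≤ M / ε`. [folklore] -/
theorem norm_fderiv_bumpAt_le (hε : 0 < ε) {M : ℝ} (hM : ∀ x : ℂ, ‖fderiv ℝ (stdBump : ℂ → ℝ) x‖ ≤ M)
    (z : ℂ) : ‖fderiv ℝ (bumpAt p ε) z‖ ≤ M * ε⁻¹ := by
  have hM0 : 0 ≤ M := (norm_nonneg _).trans (hM 0)
  have haff : HasFDerivAt (fun z : ℂ => ε⁻¹ • (z - p)) (ε⁻¹ • ContinuousLinearMap.id ℝ ℂ) z :=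
    ((hasFDerivAt_id (𝕜 := ℝ) z).sub_const p).fun_const_smul ε⁻¹
  have hcomp : HasFDerivAt (bumpAt p ε)
      ((fderiv ℝ (stdBump : ℂ → ℝ) (ε⁻¹ • (z - p))).comp (ε⁻¹ • ContinuousLinearMap.id ℝ ℂ)) z :=
    ((stdBump.contDiff (n := 1)).differentiable one_ne_zero _).hasFDerivAt.comp z haff
  rw [hcomp.fderiv]
  refine (ContinuousLinearMap.opNorm_comp_le _ _).trans ?_
  refine mul_le_mul (hM _) ?_ (norm_nonneg _) hM0
  rw [norm_smul, Real.norm_eq_abs, abs_inv, abs_of_pos hε]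
  calc ε⁻¹ * ‖ContinuousLinearMap.id ℝ ℂ‖ ≤ ε⁻¹ * 1 := by
        gcongr; exact ContinuousLinearMap.norm_id_le
    _ = ε⁻¹ := mul_one _

/-- The derivative of the scaled bump vanishes off `closedBall p (2ε)`. [folklore] -/
theorem fderiv_bumpAt_eq_zero (hε : 0 < ε) (hz : z ∉ closedBall p (2 * ε)) :
    fderiv ℝ (bumpAt p ε) z = 0 :=
  fderiv_of_notMem_tsupport ℝ fun h => hz (tsupport_bumpAt_subset hε h)

/-- `T` is `4ε`-separated. [folklore] -/
def Separated (T : Finset ℂ) (ε : ℝ) : Prop := ∀ p ∈ T, ∀ p' ∈ T, p ≠ p' → 4 * ε ≤ dist p p'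

/-- **A finite set is `4ε`-separated for all small `ε > 0`.** [folklore] -/
theorem exists_separated (T : Finset ℂ) : ∃ ε₀ : ℝ, 0 < ε₀ ∧ ∀ ε, 0 < ε → ε ≤ ε₀ → Separated T ε := by
  classical
  set D : Finset ℝ := T.offDiag.image fun pp => dist pp.1 pp.2 with hD
  by_cases hDn : D.Nonempty
  · have hpos : 0 < D.min' hDn := by
      rw [Finset.lt_min'_iff]
      intro x hx
      obtain ⟨pp, hpp, rfl⟩ := Finset.mem_image.1 hx
      rw [Finset.mem_offDiag] at hpp
      exact dist_pos.2 hpp.2.2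
    refine ⟨D.min' hDn / 4, by positivity, fun ε hε hεle p hp p' hp' hne => ?_⟩
    have hmem : dist p p' ∈ D := Finset.mem_image.2 ⟨(p, p'), Finset.mem_offDiag.2 ⟨hp, hp', hne⟩, rfl⟩
    have := D.min'_le _ hmem
    linarith
  · refine ⟨1, one_pos, fun ε _ _ p hp p' hp' hne => ?_⟩
    exact absurd ⟨dist p p', Finset.mem_image.2 ⟨(p, p'), Finset.mem_offDiag.2 ⟨hp, hp', hne⟩, rfl⟩⟩ hDn

/-- At most one bump of a separated family is non-zero at a point: the sum of the bumps is at
most `1`. [folklore] -/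
theorem sum_bumpAt_le_one (hε : 0 < ε) (hT : Separated T ε) (z : ℂ) :
    ∑ p ∈ T, bumpAt p ε z ≤ 1 := by
  classical
  by_cases h : ∃ p ∈ T, bumpAt p ε z ≠ 0
  · obtain ⟨p, hp, hpz⟩ := h
    have hdp : dist z p < 2 * ε := by
      by_contra h'; exact hpz (bumpAt_eq_zero hε (not_lt.1 h'))
    rw [← Finset.add_sum_erase _ _ hp]
    have hrest : ∑ p' ∈ T.erase p, bumpAt p' ε z = 0 := by
      refine Finset.sum_eq_zero fun p' hp' => ?_
      obtain ⟨hne, hp'T⟩ := Finset.mem_erase.1 hp'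
      refine bumpAt_eq_zero hε ?_
      by_contra h'
      have h4 := hT p hp p' hp'T (Ne.symm hne)
      have := dist_triangle_left p p' z
      linarith [not_le.1 h']
    rw [hrest, add_zero]
    exact bumpAt_le_one
  · push Not at h
    rw [Finset.sum_eq_zero h]
    exact zero_le_one

/-- The cutoff takes values in `[0, 1]` (separated case). [folklore] -/
theorem cutoff_mem_Icc (hε : 0 < ε) (hT : Separated T ε) (z : ℂ) : cutoff T ε z ∈ Icc (0 : ℝ) 1 := by
  have h1 := sum_bumpAt_le_one hε hT z
  have h0 : 0 ≤ ∑ p ∈ T, bumpAt p ε z := Finset.sum_nonneg fun _ _ => bumpAt_nonneg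
  simp only [cutoff, mem_Icc]
  constructor <;> linarith

/-- **The cutoff vanishes near the points of `T`** (on `ball p ε`). [folklore] -/
theorem cutoff_eventuallyEq_zero (hε : 0 < ε) (hT : Separated T ε) (hp : p ∈ T) :
    cutoff T ε =ᶠ[𝓝 p] fun _ => 0 := by
  classical
  filter_upwards [ball_mem_nhds p hε] with z hz
  have hzp : bumpAt p ε z = 1 := bumpAt_eq_one hε (le_of_lt (mem_ball.1 hz))
  have h1 := sum_bumpAt_le_one hε hT z
  rw [← Finset.add_sum_erase _ _ hp, hzp] at h1
  have h0 : 0 ≤ ∑ p' ∈ T.erase p, bumpAt p' ε z := Finset.sum_nonneg fun _ _ => bumpAt_nonneg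
  have hrest : ∑ p' ∈ T.erase p, bumpAt p' ε z = 0 := le_antisymm (by linarith) h0
  simp only [cutoff]
  rw [← Finset.add_sum_erase _ _ hp, hzp, hrest]
  ring

/-- **The cutoff is `1` off the `2ε`-discs.** [folklore] -/
theorem cutoff_eq_one (hε : 0 < ε) (hz : ∀ p ∈ T, 2 * ε ≤ dist z p) : cutoff T ε z = 1 := by
  simp only [cutoff]
  rw [Finset.sum_eq_zero fun p hp => bumpAt_eq_zero hε (hz p hp), sub_zero]

/-- The derivative of the cutoff. [folklore] -/
theorem fderiv_cutoff (z : ℂ) : fderiv ℝ (cutoff T ε) z = -∑ p ∈ T, fderiv ℝ (bumpAt p ε) z := by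
  have h : HasFDerivAt (cutoff T ε) ((0 : ℂ →L[ℝ] ℝ) - ∑ p ∈ T, fderiv ℝ (bumpAt p ε) z) z :=
    (hasFDerivAt_const (1 : ℝ) z).sub (HasFDerivAt.fun_sum fun p _ =>
      ((contDiff_bumpAt p ε (n := 1)).differentiable one_ne_zero z).hasFDerivAt)
  rw [h.fderiv, zero_sub]

end Cutoff


/-! ### Measure-theoretic helpers -/

/-- **Cauchy–Schwarz on a set**: `∫_S ‖f‖ ≤ (vol S)^{1/2} (∫_S ‖f‖²)^{1/2}`. [folklore] -/
theorem setLIntegral_enorm_le_sqrt {f : ℂ → ℂ} (hf : AEStronglyMeasurable f volume) (S : Set ℂ) :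
    ∫⁻ z in S, ‖f z‖ₑ ≤ volume S ^ (1 / 2 : ℝ) * (∫⁻ z in S, ‖f z‖ₑ ^ 2) ^ (1 / 2 : ℝ) := by
  have h := ENNReal.lintegral_mul_le_Lp_mul_Lq (volume.restrict S) Real.HolderConjugate.two_two
    (f := fun _ => (1 : ℝ≥0∞)) (g := fun z => ‖f z‖ₑ) aemeasurable_const
    (hf.enorm.mono_measure Measure.restrict_le_self)
  simp only [one_mul, ENNReal.one_rpow, lintegral_const, Measure.restrict_apply_univ] at h
  convert h using 3
  · norm_num
  · refine lintegral_congr fun z => ?_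
    rw [← ENNReal.rpow_natCast]; norm_num

/-- The area of a disc of radius `r` in `ℂ`: `r² · area (unit disc)`. [folklore] -/
theorem volume_closedBall_eq (p : ℂ) {r : ℝ} (hr : 0 ≤ r) :
    volume (closedBall p r) = ENNReal.ofReal (r ^ 2) * volume (ball (0 : ℂ) 1) := by
  rw [Measure.addHaar_closedBall volume p hr, Complex.finrank_real_complex]

/-- The square root of the area of a disc of radius `r`. [folklore] -/
theorem volume_closedBall_rpow_half (p : ℂ) {r : ℝ} (hr : 0 ≤ r) :
    volume (closedBall p r) ^ (1 / 2 : ℝ) = ENNReal.ofReal r * volume (ball (0 : ℂ) 1) ^ (1 / 2 : ℝ) := by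
  rw [volume_closedBall_eq p hr, ENNReal.mul_rpow_of_nonneg _ _ (by norm_num : (0 : ℝ) ≤ 1 / 2),
    ENNReal.ofReal_rpow_of_nonneg (by positivity) (by norm_num : (0 : ℝ) ≤ 1 / 2), ← Real.sqrt_eq_rpow,
    Real.sqrt_sq hr]

/-- The measure of the `2ε`-discs around a finite set tends to `0` with `ε`. [folklore] -/
theorem tendsto_volume_biUnion_closedBall (T : Finset ℂ) :
    Tendsto (fun ε : ℝ => volume (⋃ p ∈ T, closedBall p (2 * ε))) (𝓝[>] 0) (𝓝 0) := by
  have hbound : ∀ ε : ℝ, 0 < ε → volume (⋃ p ∈ T, closedBall p (2 * ε)) ≤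
      T.card * (ENNReal.ofReal ((2 * ε) ^ 2) * volume (ball (0 : ℂ) 1)) := by
    intro ε hε
    refine (measure_biUnion_finset_le _ _).trans ?_
    rw [Finset.sum_congr rfl fun p _ => volume_closedBall_eq p (by positivity : (0 : ℝ) ≤ 2 * ε),
      Finset.sum_const, nsmul_eq_mul]
  have hlim : Tendsto (fun ε : ℝ => (T.card : ℝ≥0∞) * (ENNReal.ofReal ((2 * ε) ^ 2) * volume (ball (0 : ℂ) 1)))
      (𝓝[>] 0) (𝓝 0) := by
    have h0 : Tendsto (fun ε : ℝ => ENNReal.ofReal ((2 * ε) ^ 2)) (𝓝[>] 0) (𝓝 0) := by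
      have : Tendsto (fun ε : ℝ => (2 * ε) ^ 2) (𝓝 0) (𝓝 0) := by
        have hc : Continuous fun ε : ℝ => (2 * ε) ^ 2 := by fun_prop
        simpa using hc.tendsto 0
      simpa using (ENNReal.tendsto_ofReal this).mono_left nhdsWithin_le_nhds
    have h1 : Tendsto (fun ε : ℝ => ENNReal.ofReal ((2 * ε) ^ 2) * volume (ball (0 : ℂ) 1)) (𝓝[>] 0) (𝓝 0) := by
      simpa using ENNReal.Tendsto.mul_const h0 (Or.inr measure_ball_lt_top.ne)
    simpa using ENNReal.Tendsto.const_mul h1 (Or.inr (ENNReal.natCast_ne_top _))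
  refine tendsto_of_tendsto_of_tendsto_of_le_of_le' tendsto_const_nhds hlim
    (Eventually.of_forall fun _ => zero_le) ?_
  exact eventually_nhdsWithin_of_forall fun ε hε => hbound ε hε

/-- Integral bound for a bounded multiplier supported in a set. [folklore] -/
theorem lintegral_ofReal_mul_le {φ : ℂ → ℝ} {A : Set ℂ} {c : ℝ}
    (hφ : ∀ z, |φ z| ≤ c) (hφA : ∀ z ∉ A, φ z = 0) (f : ℂ → ℂ) :
    ∫⁻ z, ‖((φ z : ℝ) : ℂ) * f z‖ₑ ≤ ENNReal.ofReal c * ∫⁻ z in A, ‖f z‖ₑ := by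
  have hpt : ∀ z, ‖((φ z : ℝ) : ℂ) * f z‖ₑ ≤ A.indicator (fun z => ENNReal.ofReal c * ‖f z‖ₑ) z := by
    intro z
    by_cases hz : z ∈ A
    · rw [indicator_of_mem hz, enorm_mul]
      gcongr
      rw [← ofReal_norm, Complex.norm_real, Real.norm_eq_abs]
      exact ENNReal.ofReal_le_ofReal (hφ z)
    · rw [indicator_of_notMem hz, hφA z hz]
      simp
  calc ∫⁻ z, ‖((φ z : ℝ) : ℂ) * f z‖ₑ ≤ ∫⁻ z, A.indicator (fun z => ENNReal.ofReal c * ‖f z‖ₑ) z :=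
        lintegral_mono hpt
    _ ≤ ∫⁻ z in A, ENNReal.ofReal c * ‖f z‖ₑ := lintegral_indicator_le _ _
    _ = ENNReal.ofReal c * ∫⁻ z in A, ‖f z‖ₑ := lintegral_const_mul' _ _ ENNReal.ofReal_ne_top


/-- Linear growth implies quadratic growth: `C (1 + x) ≤ 2C (1 + x²)` for `C ≥ 0`. [folklore] -/
theorem linear_le_quadratic {C : ℝ} (hC : 0 ≤ C) (x : ℝ) : C * (1 + x) ≤ 2 * C * (1 + x ^ 2) := by
  nlinarith [mul_nonneg hC (sq_nonneg (2 * x - 1)), mul_nonneg hC (sq_nonneg x)]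

/-- The derivative bound of a scaled bump in a direction, as an indicator bound. [folklore] -/
theorem abs_fderiv_bumpAt_apply_le {p : ℂ} {ε : ℝ} (hε : 0 < ε) {M : ℝ}
    (hM : ∀ x : ℂ, ‖fderiv ℝ (stdBump : ℂ → ℝ) x‖ ≤ M) (v z : ℂ) :
    |fderiv ℝ (bumpAt p ε) z v| ≤ M * ε⁻¹ * ‖v‖ := by
  rw [← Real.norm_eq_abs]
  exact ((fderiv ℝ (bumpAt p ε) z).le_opNorm v).trans
    (mul_le_mul_of_nonneg_right (norm_fderiv_bumpAt_le hε hM z) (norm_nonneg v))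


/-! ### Stokes' theorem: the cutoff estimate -/

section Estimate

variable {P Q H : ℂ → ℂ} {T : Finset ℂ} {ε M : ℝ}

/-- The complexified cutoff. [folklore] -/
def cutoffC (T : Finset ℂ) (ε : ℝ) (z : ℂ) : ℂ := ((cutoff T ε z : ℝ) : ℂ)

/-- Smoothness of the complexified cutoff. [folklore] -/
theorem contDiff_cutoffC (T : Finset ℂ) (ε : ℝ) {n : ℕ∞} : ContDiff ℝ n (cutoffC T ε) :=
  ofRealCLM.contDiff.comp (contDiff_cutoff T ε)

/-- The derivative of the complexified cutoff. [folklore] -/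
theorem fderiv_cutoffC_apply (T : Finset ℂ) (ε : ℝ) (z v : ℂ) :
    fderiv ℝ (cutoffC T ε) z v = ((fderiv ℝ (cutoff T ε) z v : ℝ) : ℂ) := by
  have h : HasFDerivAt (cutoffC T ε) (ofRealCLM.comp (fderiv ℝ (cutoff T ε) z)) z :=
    ofRealCLM.hasFDerivAt.comp z ((contDiff_cutoff T ε (n := 1)).differentiable one_ne_zero z).hasFDerivAt
  rw [h.fderiv]; rfl

/-- **The cutoff estimate.** Let `P`, `Q` be integrable, `C¹` off a finite set `T`, with
`∂₁ Q - ∂_i P = H` off `T` (`H` integrable), all three supported in a compact set. Then for every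
`4ε`-separated scale,
`‖∫ H‖ ≤ ∫_{2ε-discs} ‖H‖ + Σ_{p ∈ T} 2M √(area 𝔻) (‖Q‖_{L²(B̄(p,2ε))} + ‖P‖_{L²(B̄(p,2ε))})`,
`M` a bound for the derivative of the standard bump: integrate `∂₁(ψQ) - ∂_i(ψP) = ψ H + ∂₁ψ Q - ∂_iψ P`
(which has integral zero) and estimate the error by Cauchy–Schwarz.
[cite: GriffithsHarrisPrinciples1978, Ch. 0 §2] -/
theorem enorm_integral_le_of_separated (hPi : Integrable P volume) (hQi : Integrable Q volume)
    (hHi : Integrable H volume) {K₁ : Set ℂ} (hK₁ : IsCompact K₁) (hPK : ∀ z ∉ K₁, P z = 0)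
    (hQK : ∀ z ∉ K₁, Q z = 0)
    (hC1 : ∀ z, z ∉ (T : Set ℂ) → ContDiffAt ℝ 1 P z ∧ ContDiffAt ℝ 1 Q z)
    (hreg : ∀ z, z ∉ (T : Set ℂ) → fderiv ℝ Q z 1 - fderiv ℝ P z I = H z)
    (hM : ∀ x : ℂ, ‖fderiv ℝ (stdBump : ℂ → ℝ) x‖ ≤ M) (hε : 0 < ε) (hT : Separated T ε) :
    ‖∫ z, H z‖ₑ ≤ (∫⁻ z in ⋃ p ∈ T, closedBall p (2 * ε), ‖H z‖ₑ) +
      ∑ p ∈ T, ENNReal.ofReal (2 * M) * volume (ball (0 : ℂ) 1) ^ (1 / 2 : ℝ) *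
        ((∫⁻ z in closedBall p (2 * ε), ‖Q z‖ₑ ^ 2) ^ (1 / 2 : ℝ) +
         (∫⁻ z in closedBall p (2 * ε), ‖P z‖ₑ ^ 2) ^ (1 / 2 : ℝ)) := by
  classical
  have hM0 : 0 ≤ M := (norm_nonneg _).trans (hM 0)
  -- the cutoff and its properties
  set ψ := cutoff T ε with hψ
  set ψC := cutoffC T ε with hψC
  have hψ01 : ∀ z, ψ z ∈ Icc (0 : ℝ) 1 := cutoff_mem_Icc hε hT
  have hψC_le : ∀ z, ‖ψC z‖ ≤ 1 := fun z => by
    rw [hψC, cutoffC, Complex.norm_real, Real.norm_eq_abs, abs_le]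
    exact ⟨by linarith [(hψ01 z).1], (hψ01 z).2⟩
  have hψCd : ContDiff ℝ 1 ψC := contDiff_cutoffC T ε
  have hψCc : Continuous ψC := hψCd.continuous
  have hzero : ∀ p ∈ T, ψC =ᶠ[𝓝 p] fun _ => 0 := fun p hp => by
    filter_upwards [cutoff_eventuallyEq_zero hε hT hp] with z hz
    simp [hψC, cutoffC, hz]
  -- the modified functions
  set F : ℂ → ℂ := ψC * P with hF
  set G : ℂ → ℂ := ψC * Q with hG
  have hFd : ContDiff ℝ 1 F := by
    rw [contDiff_iff_contDiffAt]
    intro z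
    by_cases hz : z ∈ (T : Set ℂ)
    · refine (contDiffAt_const (c := (0 : ℂ))).congr_of_eventuallyEq ?_
      filter_upwards [hzero z hz] with y hy
      simp [hF, hy]
    · exact hψCd.contDiffAt.mul (hC1 z hz).1
  have hGd : ContDiff ℝ 1 G := by
    rw [contDiff_iff_contDiffAt]
    intro z
    by_cases hz : z ∈ (T : Set ℂ)
    · refine (contDiffAt_const (c := (0 : ℂ))).congr_of_eventuallyEq ?_
      filter_upwards [hzero z hz] with y hy
      simp [hG, hy]
    · exact hψCd.contDiffAt.mul (hC1 z hz).2
  have hFc : HasCompactSupport F := HasCompactSupport.intro hK₁ fun z hz => by simp [hF, hPK z hz]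
  have hGc : HasCompactSupport G := HasCompactSupport.intro hK₁ fun z hz => by simp [hG, hQK z hz]
  -- `∫ ∂F = 0`, `∫ ∂G = 0`
  have hF0 : ∫ z, fderiv ℝ F z I = 0 := integral_fderiv_apply_eq_zero hFd hFc I
  have hG0 : ∫ z, fderiv ℝ G z 1 = 0 := integral_fderiv_apply_eq_zero hGd hGc 1
  -- pointwise identity
  have hpt : ∀ z, fderiv ℝ G z 1 - fderiv ℝ F z I =
      ψC z * H z + (((fderiv ℝ ψ z 1 : ℝ) : ℂ) * Q z - ((fderiv ℝ ψ z I : ℝ) : ℂ) * P z) := by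
    intro z
    by_cases hz : z ∈ (T : Set ℂ)
    · have hF0' : F =ᶠ[𝓝 z] fun _ => 0 := by
        filter_upwards [hzero z hz] with y hy; simp [hF, hy]
      have hG0' : G =ᶠ[𝓝 z] fun _ => 0 := by
        filter_upwards [hzero z hz] with y hy; simp [hG, hy]
      have hψz : ψC z = 0 := (hzero z hz).self_of_nhds
      have hψ'z : fderiv ℝ ψ z = 0 := by
        rw [(cutoff_eventuallyEq_zero hε hT hz).fderiv_eq]; simp
      rw [hF0'.fderiv_eq, hG0'.fderiv_eq, hψz, hψ'z]
      simp
    · have hPd : HasFDerivAt P (fderiv ℝ P z) z := ((hC1 z hz).1.differentiableAt one_ne_zero).hasFDerivAt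
      have hQd : HasFDerivAt Q (fderiv ℝ Q z) z := ((hC1 z hz).2.differentiableAt one_ne_zero).hasFDerivAt
      have hψd : HasFDerivAt ψC (fderiv ℝ ψC z) z := (hψCd.differentiable one_ne_zero z).hasFDerivAt
      rw [(hψd.mul hQd).fderiv, (hψd.mul hPd).fderiv, ← hreg z hz]
      simp only [add_apply, FunLike.coe_smul, Pi.smul_apply,
        smul_eq_mul, hψC, fderiv_cutoffC_apply]
      ring
  -- integrability of the pieces
  have hψH : Integrable (fun z => ψC z * H z) volume :=
    hHi.bdd_mul hψCc.aestronglyMeasurable (ae_of_all _ hψC_le)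
  have hbd : ∀ v : ℂ, ∀ z, ‖((fderiv ℝ ψ z v : ℝ) : ℂ)‖ ≤ T.card * (M * ε⁻¹ * ‖v‖) := by
    intro v z
    rw [Complex.norm_real, Real.norm_eq_abs, hψ, fderiv_cutoff, neg_apply, abs_neg,
      _root_.sum_apply]
    refine (Finset.abs_sum_le_sum_abs _ _).trans ?_
    calc ∑ p ∈ T, |fderiv ℝ (bumpAt p ε) z v| ≤ ∑ _p ∈ T, M * ε⁻¹ * ‖v‖ :=
          Finset.sum_le_sum fun p _ => abs_fderiv_bumpAt_apply_le hε hM v z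
      _ = T.card * (M * ε⁻¹ * ‖v‖) := by rw [Finset.sum_const, nsmul_eq_mul]
  have hψ'c : ∀ v : ℂ, Continuous fun z => ((fderiv ℝ ψ z v : ℝ) : ℂ) := fun v =>
    continuous_ofReal.comp (((contDiff_cutoff T ε (n := 1)).continuous_fderiv one_ne_zero).clm_apply
      continuous_const)
  have hψ'Q : Integrable (fun z => ((fderiv ℝ ψ z 1 : ℝ) : ℂ) * Q z) volume :=
    hQi.bdd_mul (hψ'c 1).aestronglyMeasurable (ae_of_all _ (hbd 1))
  have hψ'P : Integrable (fun z => ((fderiv ℝ ψ z I : ℝ) : ℂ) * P z) volume :=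
    hPi.bdd_mul (hψ'c I).aestronglyMeasurable (ae_of_all _ (hbd I))
  have hdG : Integrable (fun z => fderiv ℝ G z 1) volume :=
    ((hGd.continuous_fderiv one_ne_zero).clm_apply continuous_const).integrable_of_hasCompactSupport
      (hGc.fderiv_apply (𝕜 := ℝ) 1)
  have hdF : Integrable (fun z => fderiv ℝ F z I) volume :=
    ((hFd.continuous_fderiv one_ne_zero).clm_apply continuous_const).integrable_of_hasCompactSupport
      (hFc.fderiv_apply (𝕜 := ℝ) I)
  -- integrate the pointwise identity: `∫ ψ H = -(∫ ∂₁ψ Q - ∫ ∂_iψ P)`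
  have hint : ∫ z, ψC z * H z = -(∫ z, ((fderiv ℝ ψ z 1 : ℝ) : ℂ) * Q z) +
      ∫ z, ((fderiv ℝ ψ z I : ℝ) : ℂ) * P z := by
    have h1 : ∫ z, (fderiv ℝ G z 1 - fderiv ℝ F z I) = 0 := by
      rw [integral_sub hdG hdF, hG0, hF0, sub_zero]
    have h2 : ∫ z, (fderiv ℝ G z 1 - fderiv ℝ F z I) =
        (∫ z, ψC z * H z) + ((∫ z, ((fderiv ℝ ψ z 1 : ℝ) : ℂ) * Q z) -
          ∫ z, ((fderiv ℝ ψ z I : ℝ) : ℂ) * P z) := by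
      have hQP : Integrable (fun z => ((fderiv ℝ ψ z 1 : ℝ) : ℂ) * Q z - ((fderiv ℝ ψ z I : ℝ) : ℂ) * P z) volume :=
        hψ'Q.sub hψ'P
      rw [integral_congr_ae (ae_of_all _ hpt), integral_add hψH hQP, integral_sub hψ'Q hψ'P]
    rw [h2] at h1
    linear_combination h1
  -- `∫ H = ∫ (1 - ψ) H + ∫ ψ H`
  have hsplit : ∫ z, H z = (∫ z, (1 - ψC z) * H z) + ∫ z, ψC z * H z := by
    rw [← integral_add ?_ hψH]
    · exact integral_congr_ae (ae_of_all _ fun z => by ring)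
    · have : (fun z => (1 - ψC z) * H z) = fun z => H z - ψC z * H z := by funext z; ring
      rw [this]; exact hHi.sub hψH
  -- Estimate 1: `‖∫ (1 - ψ) H‖ ≤ ∫_{discs} ‖H‖`
  have hE1 : ‖∫ z, (1 - ψC z) * H z‖ₑ ≤ ∫⁻ z in ⋃ p ∈ T, closedBall p (2 * ε), ‖H z‖ₑ := by
    refine (enorm_integral_le_lintegral_enorm _).trans ?_
    have h := lintegral_ofReal_mul_le (φ := fun z => 1 - ψ z) (A := ⋃ p ∈ T, closedBall p (2 * ε))
      (c := 1) (fun z => ?_) (fun z hz => ?_) H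
    · simpa [hψC, cutoffC] using h
    · rw [abs_le]; constructor <;> linarith [(hψ01 z).1, (hψ01 z).2]
    · rw [hψ, cutoff_eq_one hε fun p hp => ?_, sub_self]
      by_contra h'
      exact hz (mem_biUnion hp (mem_closedBall.2 (le_of_lt (not_le.1 h'))))
  -- Estimate 2: `‖∫ ∂_vψ R‖ ≤ Σ_p 2M √(area 𝔻) ‖R‖_{L²(B̄(p,2ε))}` for `R = P, Q`, `‖v‖ = 1`
  have hE2 : ∀ (R : ℂ → ℂ), AEStronglyMeasurable R volume → ∀ v : ℂ, ‖v‖ = 1 →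
      ‖∫ z, ((fderiv ℝ ψ z v : ℝ) : ℂ) * R z‖ₑ ≤
        ∑ p ∈ T, ENNReal.ofReal (2 * M) * volume (ball (0 : ℂ) 1) ^ (1 / 2 : ℝ) *
          (∫⁻ z in closedBall p (2 * ε), ‖R z‖ₑ ^ 2) ^ (1 / 2 : ℝ) := by
    intro R hRm v hv
    refine (enorm_integral_le_lintegral_enorm _).trans ?_
    -- expand the derivative of the cutoff as a sum over the bumps
    have hexp : ∀ z, ((fderiv ℝ ψ z v : ℝ) : ℂ) * R z =
        ∑ p ∈ T, (-(((fderiv ℝ (bumpAt p ε) z v : ℝ) : ℂ) * R z)) := by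
      intro z
      rw [hψ, fderiv_cutoff, neg_apply, _root_.sum_apply]
      push_cast
      rw [Finset.sum_neg_distrib, neg_mul, Finset.sum_mul]
    have hmeas : ∀ p ∈ T, AEMeasurable (fun z => ‖-(((fderiv ℝ (bumpAt p ε) z v : ℝ) : ℂ) * R z)‖ₑ) volume := by
      intro p _
      refine (AEStronglyMeasurable.enorm ?_)
      refine ((Continuous.aestronglyMeasurable ?_).mul hRm).neg
      exact continuous_ofReal.comp (((contDiff_bumpAt p ε (n := 1)).continuous_fderiv one_ne_zero).clm_apply
        continuous_const)
    calc ∫⁻ z, ‖((fderiv ℝ ψ z v : ℝ) : ℂ) * R z‖ₑ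
        = ∫⁻ z, ‖∑ p ∈ T, (-(((fderiv ℝ (bumpAt p ε) z v : ℝ) : ℂ) * R z))‖ₑ := by
          simp_rw [hexp]
      _ ≤ ∫⁻ z, ∑ p ∈ T, ‖-(((fderiv ℝ (bumpAt p ε) z v : ℝ) : ℂ) * R z)‖ₑ :=
          lintegral_mono fun z => enorm_sum_le _ _
      _ = ∑ p ∈ T, ∫⁻ z, ‖-(((fderiv ℝ (bumpAt p ε) z v : ℝ) : ℂ) * R z)‖ₑ := lintegral_finsetSum' _ hmeas
      _ ≤ ∑ p ∈ T, ENNReal.ofReal (M * ε⁻¹ * ‖v‖) * ∫⁻ z in closedBall p (2 * ε), ‖R z‖ₑ := by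
          refine Finset.sum_le_sum fun p _ => ?_
          simp_rw [enorm_neg]
          exact lintegral_ofReal_mul_le (fun z => abs_fderiv_bumpAt_apply_le hε hM v z)
            (fun z hz => by rw [fderiv_bumpAt_eq_zero hε hz]; simp) R
      _ ≤ ∑ p ∈ T, ENNReal.ofReal (M * ε⁻¹ * ‖v‖) * (volume (closedBall p (2 * ε)) ^ (1 / 2 : ℝ) *
            (∫⁻ z in closedBall p (2 * ε), ‖R z‖ₑ ^ 2) ^ (1 / 2 : ℝ)) := by
          gcongr with p hp
          exact setLIntegral_enorm_le_sqrt hRm _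
      _ = ∑ p ∈ T, ENNReal.ofReal (2 * M) * volume (ball (0 : ℂ) 1) ^ (1 / 2 : ℝ) *
            (∫⁻ z in closedBall p (2 * ε), ‖R z‖ₑ ^ 2) ^ (1 / 2 : ℝ) := by
          refine Finset.sum_congr rfl fun p _ => ?_
          rw [volume_closedBall_rpow_half p (by positivity : (0 : ℝ) ≤ 2 * ε), hv, mul_one, ← mul_assoc,
            ← mul_assoc, ← ENNReal.ofReal_mul (by positivity)]
          congr 2
          field_simp
  -- assemble
  calc ‖∫ z, H z‖ₑ = ‖(∫ z, (1 - ψC z) * H z) + (-(∫ z, ((fderiv ℝ ψ z 1 : ℝ) : ℂ) * Q z) +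
        ∫ z, ((fderiv ℝ ψ z I : ℝ) : ℂ) * P z)‖ₑ := by rw [hsplit, hint]
    _ ≤ ‖∫ z, (1 - ψC z) * H z‖ₑ + (‖∫ z, ((fderiv ℝ ψ z 1 : ℝ) : ℂ) * Q z‖ₑ +
        ‖∫ z, ((fderiv ℝ ψ z I : ℝ) : ℂ) * P z‖ₑ) := by
        refine (enorm_add_le _ _).trans (add_le_add le_rfl ((enorm_add_le _ _).trans ?_))
        rw [enorm_neg]
    _ ≤ (∫⁻ z in ⋃ p ∈ T, closedBall p (2 * ε), ‖H z‖ₑ) +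
        (∑ p ∈ T, ENNReal.ofReal (2 * M) * volume (ball (0 : ℂ) 1) ^ (1 / 2 : ℝ) *
            (∫⁻ z in closedBall p (2 * ε), ‖Q z‖ₑ ^ 2) ^ (1 / 2 : ℝ) +
          ∑ p ∈ T, ENNReal.ofReal (2 * M) * volume (ball (0 : ℂ) 1) ^ (1 / 2 : ℝ) *
            (∫⁻ z in closedBall p (2 * ε), ‖P z‖ₑ ^ 2) ^ (1 / 2 : ℝ)) :=
        add_le_add hE1 (add_le_add (hE2 Q hQi.aestronglyMeasurable 1 (by simp))
          (hE2 P hPi.aestronglyMeasurable I (by simp)))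
    _ = _ := by rw [← Finset.sum_add_distrib]; simp_rw [← mul_add]

/-- **The error term tends to zero** as `ε → 0⁺` (absolute continuity of the integral).
[folklore] -/
theorem tendsto_error (T : Finset ℂ) (hP : ∫⁻ z, ‖P z‖ₑ ^ 2 ≠ ∞) (hQ : ∫⁻ z, ‖Q z‖ₑ ^ 2 ≠ ∞)
    (hH : ∫⁻ z, ‖H z‖ₑ ≠ ∞) {c : ℝ≥0∞} (hc : c ≠ ∞) :
    Tendsto (fun ε : ℝ => (∫⁻ z in ⋃ p ∈ T, closedBall p (2 * ε), ‖H z‖ₑ) +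
      ∑ p ∈ T, c * ((∫⁻ z in closedBall p (2 * ε), ‖Q z‖ₑ ^ 2) ^ (1 / 2 : ℝ) +
        (∫⁻ z in closedBall p (2 * ε), ‖P z‖ₑ ^ 2) ^ (1 / 2 : ℝ))) (𝓝[>] 0) (𝓝 0) := by
  have hvol : ∀ p : ℂ, Tendsto (fun ε : ℝ => volume (closedBall p (2 * ε))) (𝓝[>] 0) (𝓝 0) := by
    intro p
    refine tendsto_of_tendsto_of_tendsto_of_le_of_le' tendsto_const_nhds
      (tendsto_volume_biUnion_closedBall {p}) (Eventually.of_forall fun _ => zero_le) ?_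
    exact Eventually.of_forall fun ε => measure_mono
      (subset_biUnion_of_mem (u := fun p => closedBall p (2 * ε)) (Finset.mem_singleton_self p))
  have hsqrt : ∀ {R : ℂ → ℂ}, ∫⁻ z, ‖R z‖ₑ ^ 2 ≠ ∞ → ∀ p : ℂ,
      Tendsto (fun ε : ℝ => (∫⁻ z in closedBall p (2 * ε), ‖R z‖ₑ ^ 2) ^ (1 / 2 : ℝ)) (𝓝[>] 0) (𝓝 0) := by
    intro R hR p
    have h1 : Tendsto (fun ε : ℝ => ∫⁻ z in closedBall p (2 * ε), ‖R z‖ₑ ^ 2) (𝓝[>] 0) (𝓝 0) :=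
      tendsto_setLIntegral_zero hR (hvol p)
    have h2 := (ENNReal.continuous_rpow_const (y := (1 / 2 : ℝ))).tendsto 0
    rw [ENNReal.zero_rpow_of_pos (by norm_num : (0 : ℝ) < 1 / 2)] at h2
    exact h2.comp h1
  have h0 : Tendsto (fun ε : ℝ => ∫⁻ z in ⋃ p ∈ T, closedBall p (2 * ε), ‖H z‖ₑ) (𝓝[>] 0) (𝓝 0) :=
    tendsto_setLIntegral_zero hH (tendsto_volume_biUnion_closedBall T)
  have hsum : Tendsto (fun ε : ℝ => ∑ p ∈ T, c * ((∫⁻ z in closedBall p (2 * ε), ‖Q z‖ₑ ^ 2) ^ (1 / 2 : ℝ) +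
        (∫⁻ z in closedBall p (2 * ε), ‖P z‖ₑ ^ 2) ^ (1 / 2 : ℝ))) (𝓝[>] 0) (𝓝 0) := by
    rw [show (0 : ℝ≥0∞) = ∑ p ∈ T, 0 by simp]
    refine tendsto_finsetSum _ fun p _ => ?_
    have h := (hsqrt hQ p).add (hsqrt hP p)
    rw [add_zero] at h
    have := ENNReal.Tendsto.const_mul h (Or.inr hc)
    rwa [mul_zero] at this
  simpa using h0.add hsum

end Estimate

/-! ### Stokes' theorem -/

namespace ZBox

variable (B : ZBox Z) {β : ℂ × ℂ → (ℂ × ℂ →L[ℝ] ℂ)}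

/-- **Stokes' theorem for the sheet-sum current of an analytic curve (box-local form).**
For a bi-Weierstrass curve `Z`, a `z`-box `B` of `Z` and a `C¹` complex `1`-form `β` on `ℂ²` with
compact support in the box, `∫ sheetSum Z (dDensity β) = 0`, i.e. `∫_Z dβ = 0`.
[cite: GriffithsHarrisPrinciples1978, Ch. 0 §2] -/
theorem integral_sheetSum_dDensity_eq_zero (hZ : BiWeierstrass Z) (hβ : ContDiff ℝ 1 β)
    (hβc : HasCompactSupport β) (hβB : tsupport β ⊆ B.box) :
    ∫ z, sheetSum Z (dDensity β) z = 0 := by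
  classical
  -- supports, bounds, continuity
  have hK : IsCompact (tsupport β) := hβc
  have hPB : SuppIn (fstDensity β) B.box := (suppIn_fstDensity β).mono hβB
  have hQB : SuppIn (sndDensity β) B.box := (suppIn_sndDensity β).mono hβB
  have hHB : SuppIn (dDensity β) B.box := (suppIn_dDensity β).mono hβB
  obtain ⟨C₀, hC₀0, hC₀⟩ := exists_bound_of_hasCompactSupport hβ.continuous hβc
  obtain ⟨C₁, hC₁0, hC₁⟩ := exists_bound_fderiv_apply₂ hβ hβc
  -- integrability
  have hHi : Integrable (sheetSum Z (dDensity β)) volume :=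
    B.integrable_sheetSum hZ hHB hK (suppIn_dDensity β) (continuous_dDensity hβ)
      (by positivity : (0 : ℝ) ≤ 4 * C₁) (norm_dDensity_le hC₁0 hC₁)
  have hPi : Integrable (sheetSum Z (fstDensity β)) volume :=
    B.integrable_sheetSum hZ hPB hK (suppIn_fstDensity β) (continuous_fstDensity hβ.continuous)
      (by positivity : (0 : ℝ) ≤ 2 * C₀)
      (fun q σ => (norm_fstDensity_le hC₀ q σ).trans (linear_le_quadratic hC₀0 ‖σ‖))
  have hQi : Integrable (sheetSum Z (sndDensity β)) volume :=
    B.integrable_sheetSum hZ hQB hK (suppIn_sndDensity β) (continuous_sndDensity hβ.continuous)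
      (by positivity : (0 : ℝ) ≤ 2 * C₀)
      (fun q σ => (norm_sndDensity_le hC₀ q σ).trans (linear_le_quadratic hC₀0 ‖σ‖))
  have hP2 : Integrable (fun z => ‖sheetSum Z (fstDensity β) z‖ ^ 2) volume :=
    B.integrable_norm_sheetSum_sq hZ hPB hK (suppIn_fstDensity β) (continuous_fstDensity hβ.continuous)
      hC₀0 (norm_fstDensity_le hC₀)
  have hQ2 : Integrable (fun z => ‖sheetSum Z (sndDensity β) z‖ ^ 2) volume :=
    B.integrable_norm_sheetSum_sq hZ hQB hK (suppIn_sndDensity β) (continuous_sndDensity hβ.continuous)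
      hC₀0 (norm_sndDensity_le hC₀)
  -- finiteness of the lintegrals entering the error term
  have hsq : ∀ {R : ℂ → ℂ}, Integrable (fun z => ‖R z‖ ^ 2) volume → ∫⁻ z, ‖R z‖ₑ ^ 2 ≠ ∞ := by
    intro R hR
    have h := hR.hasFiniteIntegral
    rw [hasFiniteIntegral_iff_enorm] at h
    refine ne_of_lt (lt_of_le_of_lt (le_of_eq (lintegral_congr fun z => ?_)) h)
    rw [Real.enorm_eq_ofReal (by positivity), ← ofReal_norm, ENNReal.ofReal_pow (norm_nonneg _)]
  have hHfin : ∫⁻ z, ‖sheetSum Z (dDensity β) z‖ₑ ≠ ∞ :=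
    (hasFiniteIntegral_iff_enorm.1 hHi.hasFiniteIntegral).ne
  -- vanishing off the `z`-shadow of the support
  have hK₁c : IsCompact (Prod.fst '' tsupport β) := hβc.image continuous_fst
  have hvan : ∀ (g : ℂ × ℂ → ℂ → ℂ), SuppIn g (tsupport β) → ∀ y, y ∉ Prod.fst '' tsupport β →
      sheetSum Z g y = 0 := fun g hg y hy =>
    finsum_mem_eq_zero_of_forall_eq_zero fun w _ => hg (y, w) (fun hq => hy ⟨_, hq, rfl⟩) _
  -- the singular set
  set T : Finset ℂ := (B.sing_finite hβc hβB).toFinset with hT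
  have hTmem : ∀ {z : ℂ}, z ∉ (T : Set ℂ) → z ∉ B.sing β := fun {z} hz h => by
    rw [hT, Finite.coe_toFinset] at hz; exact hz h
  obtain ⟨ε₀, hε₀, hsep⟩ := exists_separated T
  obtain ⟨M, hM0, hM⟩ := exists_bound_fderiv_stdBump
  -- the estimate for all small scales, and the limit
  have hmain : ∀ᶠ ε in 𝓝[>] (0 : ℝ), ‖∫ z, sheetSum Z (dDensity β) z‖ₑ ≤
      (∫⁻ z in ⋃ p ∈ T, closedBall p (2 * ε), ‖sheetSum Z (dDensity β) z‖ₑ) +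
      ∑ p ∈ T, ENNReal.ofReal (2 * M) * volume (ball (0 : ℂ) 1) ^ (1 / 2 : ℝ) *
        ((∫⁻ z in closedBall p (2 * ε), ‖sheetSum Z (sndDensity β) z‖ₑ ^ 2) ^ (1 / 2 : ℝ) +
         (∫⁻ z in closedBall p (2 * ε), ‖sheetSum Z (fstDensity β) z‖ₑ ^ 2) ^ (1 / 2 : ℝ)) := by
    filter_upwards [Ioc_mem_nhdsGT hε₀] with ε hε
    exact enorm_integral_le_of_separated hPi hQi hHi hK₁c
      (fun z hz => hvan _ (suppIn_fstDensity β) z hz) (fun z hz => hvan _ (suppIn_sndDensity β) z hz)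
      (fun z hz => B.contDiffAt_sheetSum_of_notMem_sing hβ hβc hβB (hTmem hz))
      (fun z hz => (B.differentiableAt_sheetSum_of_notMem_sing hβ hβc hβB (hTmem hz)).2.2) hM hε.1
      (hsep ε hε.1 hε.2)
  have hlim := tendsto_error (P := sheetSum Z (fstDensity β)) (Q := sheetSum Z (sndDensity β))
    (H := sheetSum Z (dDensity β)) T (hsq hP2) (hsq hQ2) hHfin
    (c := ENNReal.ofReal (2 * M) * volume (ball (0 : ℂ) 1) ^ (1 / 2 : ℝ))
    (ENNReal.mul_ne_top ENNReal.ofReal_ne_top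
      (ENNReal.rpow_ne_top_of_nonneg (by norm_num) measure_ball_lt_top.ne))
  have hle : ‖∫ z, sheetSum Z (dDensity β) z‖ₑ ≤ 0 := ge_of_tendsto hlim hmain
  exact enorm_eq_zero.1 (le_antisymm hle zero_le)

end ZBox

end PlaneCurve

end Literature.Analysis.Complex
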